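import Summits.HodgeConjecture.HodgeConjecture.Theorems.HeckePrymWeilHyperbolicEightfoldsSqrtMinus7OfWeilFamily
import Literature.AlgebraicGeometry.HodgeTheory.InvariantClassesFromTotalSpaceHolds
import HarnessLib

/-!
# `HyperbolicEightfoldsSqrtMinus7`: the Leray stub closed, the W-engine unconditional (item stmt-HodgeConjecture-14642, route HeckePrymWeil)

Line `Sketch` of crux `HeckePrymWeil.HyperbolicEightfoldsSqrtMinus7`, skeleton v7 (continuation lead c5,
2026-08-16). Skeleton v6 (lead c3) derived the crux from THREE existing declarations
(`TensorAnchor.hyperbolicEightfoldsSqrtMinus7_of_two_facts_of_weilVariationalHodge`, file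
`…HyperbolicEightfoldsSqrtMinus7OfWeilFamily`, p108803): the named facts
`HodgeTheory.deligne1968_invariantClass_fromTotalSpace` (registered stub `stub_lerayFact`),
`HodgeTheory.deligne1982_weilFamily_hodgeWeilSection` (registered stub `stub_weilFamilyFact`) and the route
crux `WeilVariationalHodge` at `(7,4)` (registered stub `stub_tensorTransport`, stmt-HodgeConjecture-14497).

Since 17:16Z (p117333, `Literature/AlgebraicGeometry/HodgeTheory/InvariantClassesFromTotalSpaceHolds`) the
first of these is DISCHARGED in the tree: `HodgeTheory.deligne1968_invariantClass_fromTotalSpace_holds`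
(Deligne's 1968 degeneration criterion on the Leray–Serre spectral sequence of the proper submersion
`𝒳(ℂ) → S(ℂ)`, hard Lefschetz fibrewise, CW models of the base; sorry-free, axioms standard). Hence:

* the registered stub `stub_lerayFact : deligne1968_invariantClass_fromTotalSpace` is CLOSED by the tree's
  `deligne1968_invariantClass_fromTotalSpace_holds` itself (same type; not restated here);
* `stub_globalClassEngine` — the W-ENGINE of the line (every continuous section of `FiberClass f k` over
  the base of an EMBEDDED smooth projective family with smooth irreducible quasi-projective base is the
  global section of ONE class of the total space), now UNCONDITIONAL: the sibling lead's
  `HeckePrymWeilLine.stub_globalClassOfSection_of_leray` fed with the discharge;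
* `weilEightfolds_of_weilFamily_of_transport`, `hyperbolicEightfoldsSqrtMinus7_of_weilFamily_of_transport`
  — the `RungEight`-shape statement and the crux from TWO hypotheses: Deligne's Weil-family fact BY NAME
  and tensor-anchored Weil transport in dimension 8 (the registered `stub_tensorTransport`, OPEN);
* `hyperbolicEightfoldsSqrtMinus7_of_weilFamily_of_weilVariationalHodge`,
  `hyperbolicEightfoldsSqrtMinus7_of_weilFamily_of_anchorTransport` — the crux from TWO EXISTING
  DECLARATIONS: `deligne1982_weilFamily_hodgeWeilSection` and the route crux `WeilVariationalHodge`
  (stmt-HodgeConjecture-14497) at `(7,4)`, resp. `AnchorTransport.VariationalHodge` (stmt-HodgeConjecture-1076).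

So the residue of the crux on this line is now exactly {Deligne 1982 Weil family (published, accepted named
fact)} + {Weil transport in dimension 8 (open; Markman 2025 Thm. 1.5.1 one dimension up)}.
CONDITIONAL results except `stub_globalClassEngine`; no definition, no `sorry`.
-/

noncomputable section

-- single-problem summit (Problem = Summit): the mandated namespace repeats `HodgeConjecture`.
set_option linter.dupNamespace false

open CategoryTheory AlgebraicGeometry Limits MonoidalCategory CartesianMonoidalCategory
open Literature.AlgebraicGeometry Literature.AlgebraicGeometry.Motives
  Literature.AlgebraicGeometry.HodgeTheory
open Summit.HodgeConjecture.HodgeConjecture.Theorems.HeckePrymWeilLine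

namespace Summit.HodgeConjecture.HodgeConjecture.Theorems.HyperbolicEightfoldsSqrtMinus7.TensorAnchor

/-- **Stub G of line `Sketch` — the W-ENGINE, now UNCONDITIONAL.** For an EMBEDDED smooth projective family
`f : 𝒳 ⟶ S` (closed in `ℙᴺ × S`) over a smooth, quasi-projective, irreducible base, every continuous
section `σ` of `FiberClass f k → S(ℂ)` is the global section of ONE class `W ∈ Hᵏ(𝒳(ℂ); ℂ)`: Deligne 1968
at one point (`deligne1968_invariantClass_fromTotalSpace_holds`) + Ehresmann + the identity principle for flat sections, assembled by the
sibling lead's `HeckePrymWeilLine.stub_globalClassOfSection_of_leray`.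
[cite: Deligne1968, Proposition (2.1) with (2.6.3)] [cite: VoisinHodgeII2003, Thm. 4.18] -/
theorem stub_globalClassEngine :
    ∀ ⦃𝒳 S : SchemeOver ℂ⦄ (f : 𝒳 ⟶ S) (n k : ℕ), IsSmoothProjectiveFamily f n →
      (∃ (N : ℕ) (ι : 𝒳 ⟶ projectiveSpace N ℂ ⊗ S),
          IsClosedImmersion ι.left ∧ ι ≫ snd (projectiveSpace N ℂ) S = f) →
      AlgebraicGeometry.Smooth S.hom → IsQuasiProjectiveOver S → IrreducibleSpace S.left →
      ∀ (σ : ComplexPoints S → FiberClass f k), Continuous σ → (∀ s, (σ s).pt = s) →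
        ∃ W : complexBetti 𝒳 k, ∀ s, σ s = globalSection f k W s :=
  stub_globalClassOfSection_of_leray deligne1968_invariantClass_fromTotalSpace_holds

/-- **All `√-7`-Weil eightfolds (`RungEight` shape) from Deligne's Weil family and tensor-anchored
transport**: every rational `(4,4)` class of the typed Weil plane of ANY complex abelian eightfold with
`φ ≫ φ = -7` is algebraic, GIVEN the Weil-family fact `deligne1982_weilFamily_hodgeWeilSection` by name and
Weil transport in dimension 8 from a tensor-isogenous fibre (the registered `stub_tensorTransport`, OPEN).
The W-engine hypothesis of `weilEightfolds_of_engine_of_weilFamily_of_transport` is discharged by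
`stub_globalClassEngine`. CONDITIONAL on the two remaining hypotheses.
[cite: Deligne1982HodgeCycles, proof of Thm. 4.8 (pp. 47–52), Prop. 4.4, Lemma 4.5, Remark 4.10]
[cite: Markman2025SecantWeil, Thm. 1.5.1 and §1.2] -/
theorem weilEightfolds_of_weilFamily_of_transport (hWF : deligne1982_weilFamily_hodgeWeilSection)
    (hT : ∀ ⦃𝒳 S : SchemeOver ℂ⦄ (f : 𝒳 ⟶ S), IsSmoothProjectiveFamily f 8 →
      (∃ (N : ℕ) (ι : 𝒳 ⟶ projectiveSpace N ℂ ⊗ S),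
          IsClosedImmersion ι.left ∧ ι ≫ snd (projectiveSpace N ℂ) S = f) →
      IrreducibleSpace S.left → AlgebraicGeometry.Smooth S.hom → IsQuasiProjectiveOver S →
      ∀ (W : complexBetti 𝒳 8),
        (∀ s : ComplexPoints S, IsRationalClass (complexBetti.map (fiberι f s) 8 W) ∧
          IsOfHodgeType 8 (fiberOver f s) 8 4 4 (complexBetti.map (fiberι f s) 8 W)) →
        (∀ s : ComplexPoints S, ∃ (A' : AbelianVariety ℂ) (φ' : A' ⟶ A'),
          A'.dim = 8 ∧ φ' ≫ φ' = -((7 : ℤ) • 𝟙 A') ∧ Nonempty (A'.X ≅ fiberOver f s)) →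
        ∀ s₀ : ComplexPoints S,
          (∃ (Y : AbelianVariety ℂ) (Ψ : Y ⟶ Y) (e₀ : Y.X ≅ fiberOver f s₀) (A₁ : AbelianVariety ℂ)
              (f₁ : Y ⟶ A₁.prod A₁) (g₁ : A₁.prod A₁ ⟶ Y) (m : ℕ),
            A₁.dim = 4 ∧ Y.dim = 8 ∧ Ψ ≫ Ψ = -((7 : ℤ) • 𝟙 Y) ∧ 0 < m ∧ f₁ ≫ g₁ = m • 𝟙 Y ∧
              Flat f₁.hom.hom.hom.left ∧
              g₁ ≫ Ψ = AbelianVariety.prodLift (AbelianVariety.snd A₁ A₁ ≫ (-((7 : ℤ) • 𝟙 A₁)))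
                (AbelianVariety.fst A₁ A₁) ≫ g₁ ∧
              complexBetti.map e₀.hom 8 (complexBetti.map (fiberι f s₀) 8 W) ∈ weilClassesOf Y Ψ 4 7) →
          complexBetti.map (fiberι f s₀) 8 W ∈ algebraicClasses (fiberOver f s₀) 4 →
          ∀ s : ComplexPoints S, complexBetti.map (fiberι f s) 8 W ∈ algebraicClasses (fiberOver f s) 4) :
    ∀ (A : AbelianVariety ℂ) (φ : A ⟶ A), A.dim = 8 → φ ≫ φ = -((7 : ℤ) • 𝟙 A) →
      ∀ c : complexBetti A.X 8, IsRationalClass c → IsOfHodgeType 8 A.X 8 4 4 c →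
        c ∈ Module.End.eigenspace (complexBetti.map (𝟙 A + φ).hom.hom.hom 8).hom
              ((1 + Complex.I * (Real.sqrt (7 : ℝ) : ℂ)) ^ 8) ⊔
            Module.End.eigenspace (complexBetti.map (𝟙 A + φ).hom.hom.hom 8).hom
              ((1 - Complex.I * (Real.sqrt (7 : ℝ) : ℂ)) ^ 8) →
        c ∈ algebraicClasses A.X 4 :=
  weilEightfolds_of_engine_of_weilFamily_of_transport stub_globalClassEngine hWF hT

/-- **`HyperbolicEightfoldsSqrtMinus7` from Deligne's Weil family and tensor-anchored transport** (skeleton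
v7 of line `Sketch`: the composition closing the crux BY NAME from the two remaining registered stubs
`stub_weilFamilyFact`, `stub_tensorTransport`; the W-engine is proved). CONDITIONAL on these two.
[cite: Deligne1982HodgeCycles, proof of Thm. 4.8 (pp. 47–52)] [cite: Markman2025SecantWeil, §1.2] -/
theorem hyperbolicEightfoldsSqrtMinus7_of_weilFamily_of_transport
    (hWF : deligne1982_weilFamily_hodgeWeilSection)
    (hT : ∀ ⦃𝒳 S : SchemeOver ℂ⦄ (f : 𝒳 ⟶ S), IsSmoothProjectiveFamily f 8 →
      (∃ (N : ℕ) (ι : 𝒳 ⟶ projectiveSpace N ℂ ⊗ S),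
          IsClosedImmersion ι.left ∧ ι ≫ snd (projectiveSpace N ℂ) S = f) →
      IrreducibleSpace S.left → AlgebraicGeometry.Smooth S.hom → IsQuasiProjectiveOver S →
      ∀ (W : complexBetti 𝒳 8),
        (∀ s : ComplexPoints S, IsRationalClass (complexBetti.map (fiberι f s) 8 W) ∧
          IsOfHodgeType 8 (fiberOver f s) 8 4 4 (complexBetti.map (fiberι f s) 8 W)) →
        (∀ s : ComplexPoints S, ∃ (A' : AbelianVariety ℂ) (φ' : A' ⟶ A'),
          A'.dim = 8 ∧ φ' ≫ φ' = -((7 : ℤ) • 𝟙 A') ∧ Nonempty (A'.X ≅ fiberOver f s)) →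
        ∀ s₀ : ComplexPoints S,
          (∃ (Y : AbelianVariety ℂ) (Ψ : Y ⟶ Y) (e₀ : Y.X ≅ fiberOver f s₀) (A₁ : AbelianVariety ℂ)
              (f₁ : Y ⟶ A₁.prod A₁) (g₁ : A₁.prod A₁ ⟶ Y) (m : ℕ),
            A₁.dim = 4 ∧ Y.dim = 8 ∧ Ψ ≫ Ψ = -((7 : ℤ) • 𝟙 Y) ∧ 0 < m ∧ f₁ ≫ g₁ = m • 𝟙 Y ∧
              Flat f₁.hom.hom.hom.left ∧
              g₁ ≫ Ψ = AbelianVariety.prodLift (AbelianVariety.snd A₁ A₁ ≫ (-((7 : ℤ) • 𝟙 A₁)))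
                (AbelianVariety.fst A₁ A₁) ≫ g₁ ∧
              complexBetti.map e₀.hom 8 (complexBetti.map (fiberι f s₀) 8 W) ∈ weilClassesOf Y Ψ 4 7) →
          complexBetti.map (fiberι f s₀) 8 W ∈ algebraicClasses (fiberOver f s₀) 4 →
          ∀ s : ComplexPoints S, complexBetti.map (fiberι f s) 8 W ∈ algebraicClasses (fiberOver f s) 4) :
    Summit.HodgeConjecture.HodgeConjecture.Theses.HeckePrymWeil.HyperbolicEightfoldsSqrtMinus7 :=
  hyperbolicEightfoldsSqrtMinus7_of_engine_of_weilFamily_of_transport stub_globalClassEngine hWF hT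

/-- **`HyperbolicEightfoldsSqrtMinus7` from TWO existing declarations of the tree**: the accepted named fact
`deligne1982_weilFamily_hodgeWeilSection` (Deligne LNM 900, proof of Thm. 4.8) and the route crux
`WeilVariationalHodge` (stmt-HodgeConjecture-14497, OPEN) at `(7, 4)`; Deligne 1968 is no longer a
hypothesis. CONDITIONAL on exactly these two.
[cite: Deligne1982HodgeCycles, proof of Thm. 4.8 (pp. 47–52) with Prop. 4.4, Lemma 4.5, Remark 4.10] -/
theorem hyperbolicEightfoldsSqrtMinus7_of_weilFamily_of_weilVariationalHodge
    (hWF : deligne1982_weilFamily_hodgeWeilSection)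
    (hV : Summit.HodgeConjecture.HodgeConjecture.Theses.HeckePrymWeil.WeilVariationalHodge) :
    Summit.HodgeConjecture.HodgeConjecture.Theses.HeckePrymWeil.HyperbolicEightfoldsSqrtMinus7 :=
  hyperbolicEightfoldsSqrtMinus7_of_weilFamily_of_transport hWF (tensorTransport_of_weilVariationalHodge hV)

/-- **`HyperbolicEightfoldsSqrtMinus7` from the Weil-family fact and `AnchorTransport.VariationalHodge`**
(stmt-HodgeConjecture-1076). CONDITIONAL on exactly these two.
[cite: Deligne1982HodgeCycles, proof of Thm. 4.8 (pp. 47–52)] -/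
theorem hyperbolicEightfoldsSqrtMinus7_of_weilFamily_of_anchorTransport
    (hWF : deligne1982_weilFamily_hodgeWeilSection)
    (hV : Summit.HodgeConjecture.HodgeConjecture.Theses.AnchorTransport.VariationalHodge) :
    Summit.HodgeConjecture.HodgeConjecture.Theses.HeckePrymWeil.HyperbolicEightfoldsSqrtMinus7 :=
  hyperbolicEightfoldsSqrtMinus7_of_weilFamily_of_transport hWF (tensorTransport_of_anchorTransport hV)

end Summit.HodgeConjecture.HodgeConjecture.Theorems.HyperbolicEightfoldsSqrtMinus7.TensorAnchor

end
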